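import Mathlib.AlgebraicGeometry.EllipticCurve.Projective.Basic
import Mathlib.Algebra.Polynomial.SpecificDegree
import Mathlib.RingTheory.MvPolynomial.Homogeneous
import Mathlib.Algebra.MvPolynomial.Equiv
import Mathlib.Algebra.MvPolynomial.PDeriv
import Mathlib.RingTheory.Localization.FractionRing
import Literature.AlgebraicGeometry.Motives.HypersurfaceFormsNonsingular
import HarnessLib

/-!
# The Weierstrass cubic form: homogeneity, nonsingularity, absolute irreducibility

For a Weierstrass curve `W` over a commutative ring `R`, Mathlib's
`WeierstrassCurve.Projective.polynomial`,
`F = Y²Z + a₁XYZ + a₃YZ² − (X³ + a₂X²Z + a₄XZ² + a₆Z³) ∈ R[X, Y, Z]` (variables `0, 1, 2` of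
`MvPolynomial (Fin 3) R`), is the homogeneous cubic cutting out the plane projective model of `W`
(Silverman, *AEC*, III.1, "homogeneous coordinates … `E ⊂ ℙ²`"; III.3.1(c)). This file proves the
three algebraic facts about `F` needed to run the tree's projective-hypersurface machinery
(`Literature.AlgebraicGeometry.Motives.SmoothHypersurface.hypersurface`, Hartshorne I Ex. 5.8 /
II Example 3.2.6) on it:

* `WeierstrassCurve.Projective.isHomogeneous_polynomial`: `F` is homogeneous of degree `3`;
* `WeierstrassCurve.Projective.isNonsingularForm_polynomial`: over a field with `Δ ≠ 0`, `F` is a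
  *nonsingular form* in the sense of `SmoothHypersurface.IsNonsingularForm` (every prime ideal
  containing `F, ∂F/∂X, ∂F/∂Y, ∂F/∂Z` contains `X, Y, Z`) — Silverman III.1.4 / III.3.1(c)
  ("a curve given by a Weierstrass equation is nonsingular iff `Δ ≠ 0`"), read at the generic
  point of each prime via Mathlib's `WeierstrassCurve.Affine.equation_iff_nonsingular_of_Δ_ne_zero`;
* `WeierstrassCurve.Projective.irreducible_polynomial`: over a field, `F` is irreducible (hence
  absolutely irreducible, `irreducible_map_polynomial`), by the elementary argument: `−F` is a
  monic cubic in `X` over `K[Y, Z]`, and a root `r` would satisfy `r³ ≡ 0 (mod Z)`, so `r = Z s`,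
  and then `Y² ≡ 0 (mod Z)` — absurd (cf. Mathlib's `WeierstrassCurve.Affine.irreducible_polynomial`
  for the affine cubic, Silverman III.3.1 Remark).

## References

* [SilvermanAEC2009] J. H. Silverman, *The Arithmetic of Elliptic Curves*, 2nd ed., GTM 106,
  Springer 2009: III.1 (Weierstrass equations, Prop. 1.4), III.3.1.
* [Hartshorne1977] R. Hartshorne, *Algebraic Geometry*, GTM 52 (1977): I Ex. 5.8.

## Design notes

Declarations about Mathlib's `WeierstrassCurve.Projective.polynomial` are deliberate dot-notation
extensions in `namespace WeierstrassCurve.Projective` (as the other elliptic-curve preludes of this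
directory extend `namespace WeierstrassCurve`). No scheme theory is imported here; the scheme
`E_W = V₊(F) ⊂ ℙ²_K` is built in `Literature/NumberTheory/EllipticCurves/WeierstrassScheme.lean`.
-/

noncomputable section

open MvPolynomial

namespace WeierstrassCurve.Projective

variable {R : Type*} [CommRing R] (W : WeierstrassCurve.Projective R)

/-! ### Homogeneity -/

/-- The Weierstrass cubic `F = Y²Z + a₁XYZ + a₃YZ² − (X³ + a₂X²Z + a₄XZ² + a₆Z³)` is homogeneous
of degree `3` (Silverman, *AEC*, III.1: "homogeneous coordinates `X = x/z`, `Y = y/z`").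
[cite: SilvermanAEC2009, III.1] -/
theorem isHomogeneous_polynomial : W.polynomial.IsHomogeneous 3 := by
  have hX : ∀ i : Fin 3, (X i : MvPolynomial (Fin 3) R).IsHomogeneous 1 := fun i =>
    isHomogeneous_X R i
  have hC : ∀ r : R, (C r : MvPolynomial (Fin 3) R).IsHomogeneous 0 := fun r =>
    isHomogeneous_C _ r
  rw [polynomial]
  refine IsHomogeneous.sub (((((hX 1).pow 2).mul (hX 2)).add ?_).add ?_)
    (((((hX 0).pow 3).add ?_).add ?_).add ?_)
  · exact (((hC _).mul (hX 0)).mul (hX 1)).mul (hX 2)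
  · exact ((hC _).mul (hX 1)).mul ((hX 2).pow 2)
  · exact ((hC _).mul ((hX 0).pow 2)).mul (hX 2)
  · exact ((hC _).mul (hX 0)).mul ((hX 2).pow 2)
  · exact (hC _).mul ((hX 2).pow 3)

/-- `F` lies in the degree-`3` piece of the grading of `R[X, Y, Z]` by total degree. [folklore] -/
theorem polynomial_mem_homogeneousSubmodule :
    W.polynomial ∈ MvPolynomial.homogeneousSubmodule (Fin 3) R 3 :=
  (mem_homogeneousSubmodule 3 W.polynomial).mpr W.isHomogeneous_polynomial

/-! ### Nonsingularity of the form when `Δ ≠ 0` -/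

section Nonsingular

variable {K : Type*} [Field K] (W : WeierstrassCurve.Projective K)

/-- A ring homomorphism out of `K[X, Y, Z]` evaluates the Weierstrass cubic of `W` to the
Weierstrass cubic of the image curve at the images of the variables. [folklore] -/
theorem ringHom_polynomial_eq_eval {S : Type*} [CommRing S] (φ : MvPolynomial (Fin 3) K →+* S) :
    φ W.polynomial = eval (fun i => φ (X i)) ((W.map (φ.comp C)).polynomial) := by
  rw [map_polynomial, eval_map, ← coe_eval₂Hom]
  congr 1
  exact ringHom_ext (fun r => by simp) (fun i => by simp)

/-- Same for `∂F/∂X` (Mathlib `polynomialX`). [folklore] -/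
theorem ringHom_polynomialX_eq_eval {S : Type*} [CommRing S] (φ : MvPolynomial (Fin 3) K →+* S) :
    φ (pderiv 0 W.polynomial) = eval (fun i => φ (X i)) ((W.map (φ.comp C)).polynomialX) := by
  have hφ : φ = (eval₂Hom (φ.comp C) fun i => φ (X i)) :=
    ringHom_ext (fun r => by simp) (fun i => by simp)
  change φ W.polynomialX = _
  rw [map_polynomialX, eval_map, ← coe_eval₂Hom, ← hφ]

/-- Same for `∂F/∂Y` (Mathlib `polynomialY`). [folklore] -/
theorem ringHom_polynomialY_eq_eval {S : Type*} [CommRing S] (φ : MvPolynomial (Fin 3) K →+* S) :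
    φ (pderiv 1 W.polynomial) = eval (fun i => φ (X i)) ((W.map (φ.comp C)).polynomialY) := by
  have hφ : φ = (eval₂Hom (φ.comp C) fun i => φ (X i)) :=
    ringHom_ext (fun r => by simp) (fun i => by simp)
  change φ W.polynomialY = _
  rw [map_polynomialY, eval_map, ← coe_eval₂Hom, ← hφ]

/-- Same for `∂F/∂Z` (Mathlib `polynomialZ`). [folklore] -/
theorem ringHom_polynomialZ_eq_eval {S : Type*} [CommRing S] (φ : MvPolynomial (Fin 3) K →+* S) :
    φ (pderiv 2 W.polynomial) = eval (fun i => φ (X i)) ((W.map (φ.comp C)).polynomialZ) := by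
  have hφ : φ = (eval₂Hom (φ.comp C) fun i => φ (X i)) :=
    ringHom_ext (fun r => by simp) (fun i => by simp)
  change φ W.polynomialZ = _
  rw [map_polynomialZ, eval_map, ← coe_eval₂Hom, ← hφ]

/-- **The Weierstrass cubic of an elliptic curve is a nonsingular form** (the hypothesis of the
projective Jacobian criterion, Hartshorne I Ex. 5.8): if `Δ(W) ≠ 0`, every prime ideal `𝔭` of
`K[X, Y, Z]` containing `F` and its three partial derivatives contains `X`, `Y` and `Z`. Proof: in
the field `L = Frac(K[X,Y,Z]/𝔭)` the images `(x̄, ȳ, z̄)` of the variables form a point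
representative on `W_L` (still `Δ ≠ 0`) satisfying the equation with all partials vanishing; if
`z̄ ≠ 0` this contradicts Silverman III.1.4 (`Δ ≠ 0` ⇒ every point on the curve is nonsingular,
Mathlib `Affine.equation_iff_nonsingular_of_Δ_ne_zero`); if `z̄ = 0` the equation gives `x̄³ = 0`
and the vanishing of `∂F/∂Z` gives `ȳ² = 0`, so `x̄ = ȳ = z̄ = 0`, i.e. `X, Y, Z ∈ 𝔭`.
[cite: SilvermanAEC2009, III.1 Prop. 1.4(a)] -/
theorem isNonsingularForm_polynomial (hΔ : W.Δ ≠ 0) :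
    Literature.AlgebraicGeometry.Motives.SmoothHypersurface.IsNonsingularForm K
      (n := 1) W.polynomial := by
  intro 𝔭 h𝔭 hF hpd i
  haveI : 𝔭.IsPrime := h𝔭
  -- the field `L = Frac (K[X,Y,Z]/𝔭)` and the structure map `φ`
  let Q := MvPolynomial (Fin 3) K ⧸ 𝔭
  let L := FractionRing Q
  let φ : MvPolynomial (Fin 3) K →+* L := (algebraMap Q L).comp (Ideal.Quotient.mk 𝔭)
  have hφmem : ∀ a, φ a = 0 ↔ a ∈ 𝔭 := fun a => by
    change algebraMap Q L (Ideal.Quotient.mk 𝔭 a) = 0 ↔ a ∈ 𝔭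
    rw [map_eq_zero_iff _ (IsFractionRing.injective Q L), Ideal.Quotient.eq_zero_iff_mem]
  -- the point representative `P = (x̄, ȳ, z̄)` on `W_L`
  let WL : WeierstrassCurve.Projective L := W.map (φ.comp C)
  let P : Fin 3 → L := fun i => φ (X i)
  have hinj : Function.Injective (φ.comp C) := (φ.comp C).injective
  have hΔL : WL.Δ ≠ 0 := by
    change (W.map (φ.comp C)).Δ ≠ 0
    rw [map_Δ]
    exact (map_ne_zero_iff _ hinj).mpr hΔ
  have hEq : WL.Equation P := by
    change eval P WL.polynomial = 0
    rw [← ringHom_polynomial_eq_eval, hφmem]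
    exact hF
  have hX0 : eval P WL.polynomialX = 0 := by
    change eval (fun i => φ (X i)) ((W.map (φ.comp C)).polynomialX) = 0
    rw [← ringHom_polynomialX_eq_eval, hφmem]; exact hpd 0
  have hY0 : eval P WL.polynomialY = 0 := by
    change eval (fun i => φ (X i)) ((W.map (φ.comp C)).polynomialY) = 0
    rw [← ringHom_polynomialY_eq_eval, hφmem]; exact hpd 1
  have hZ0 : eval P WL.polynomialZ = 0 := by
    change eval (fun i => φ (X i)) ((W.map (φ.comp C)).polynomialZ) = 0
    rw [← ringHom_polynomialZ_eq_eval, hφmem]; exact hpd 2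
  have hns : ¬ WL.Nonsingular P := by
    rintro ⟨-, h | h | h⟩
    · exact h hX0
    · exact h hY0
    · exact h hZ0
  -- `z̄ = 0`: otherwise `P` is an affine point of a curve with `Δ ≠ 0`, hence nonsingular
  have hz : P 2 = 0 := by
    by_contra hPz
    apply hns
    rw [nonsingular_of_Z_ne_zero hPz]
    exact (Affine.equation_iff_nonsingular_of_Δ_ne_zero hΔL).mp
      ((equation_of_Z_ne_zero hPz).mp hEq)
  -- then `x̄³ = 0` and `ȳ² = 0`
  have hx : P 0 = 0 := by
    have h3 : P 0 ^ 3 = 0 := (equation_of_Z_eq_zero hz).mp hEq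
    exact pow_eq_zero_iff (n := 3) (by norm_num) |>.mp h3
  have hy : P 1 = 0 := by
    have h := (nonsingular_of_Z_eq_zero hz).not.mp hns
    rw [not_and_or] at h
    rcases h with h | h
    · exact absurd hEq h
    · rw [not_or, not_not, not_not, hx] at h
      have h2 : P 1 ^ 2 = 0 := by simpa using h.2
      exact pow_eq_zero_iff (n := 2) (by norm_num) |>.mp h2
  -- so every variable maps to `0` in `L`, i.e. lies in `𝔭`
  fin_cases i
  · exact (hφmem _).mp hx
  · exact (hφmem _).mp hy
  · exact (hφmem _).mp hz

end Nonsingular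

/-! ### Irreducibility -/

section Irreducible

variable {K : Type*} [Field K] (W : WeierstrassCurve.Projective K)

/-- Mathlib's `finSuccEquiv` sends a constant `C a` to `C (C a)`. [folklore] -/
theorem finSuccEquiv_C_eq (n : ℕ) (a : K) :
    finSuccEquiv K n (C a) = Polynomial.C (C a) := by
  simp [finSuccEquiv_apply]

/-- Under `K[X, Y, Z] ≅ K[Y, Z][X]` (Mathlib `MvPolynomial.finSuccEquiv`, singling out the variable
`X = X 0`; in `K[Y, Z] = MvPolynomial (Fin 2) K` the variable `0` is `Y` and `1` is `Z`), the
Weierstrass cubic becomes minus the monic cubic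
`X³ + a₂Z·X² + (a₄Z² − a₁YZ)·X + (a₆Z³ − a₃YZ² − Y²Z)`. [folklore] -/
theorem finSuccEquiv_polynomial :
    finSuccEquiv K 2 W.polynomial =
      -(Cubic.toPoly ⟨1, C W.a₂ * X 1, C W.a₄ * X 1 ^ 2 - C W.a₁ * X 0 * X 1,
        C W.a₆ * X 1 ^ 3 - C W.a₃ * X 0 * X 1 ^ 2 - X 0 ^ 2 * X 1⟩) := by
  rw [polynomial, show (X 1 : MvPolynomial (Fin 3) K) = X (Fin.succ 0) from rfl,
    show (X 2 : MvPolynomial (Fin 3) K) = X (Fin.succ 1) from rfl]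
  simp only [map_add, map_sub, map_mul, map_pow, finSuccEquiv_X_zero, finSuccEquiv_X_succ,
    finSuccEquiv_C_eq, Cubic.toPoly, map_one, one_mul]
  ring

/-- The substitution `Y ↦ Y`, `Z ↦ 0` on `K[Y, Z]` (reduction modulo `Z` followed by the inclusion
`K[Y] ⊆ K[Y, Z]`), as a `K`-algebra endomorphism (local notation `killZ`). [folklore] -/
local notation3 "killZ" =>
  (MvPolynomial.aeval ![X 0, 0] : MvPolynomial (Fin 2) K →ₐ[K] MvPolynomial (Fin 2) K)

/-- `killZ` fixes `Y`. [folklore] -/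
theorem killZ_X_zero : killZ (X 0) = X 0 := by
  simp

/-- `killZ` kills `Z`. [folklore] -/
theorem killZ_X_one : killZ (X 1) = 0 := by
  simp

/-- `killZ` fixes constants. [folklore] -/
theorem killZ_C (a : K) : killZ (C a) = C a := by
  simp

/-- `r ≡ killZ r (mod Z)`: the kernel of reduction modulo `Z` is generated by `Z`. [folklore] -/
theorem X_one_dvd_sub_killZ (r : MvPolynomial (Fin 2) K) : X 1 ∣ r - killZ r := by
  induction r using MvPolynomial.induction_on with
  | C a => simp
  | add p q hp hq =>
      rw [map_add, add_sub_add_comm]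
      exact dvd_add hp hq
  | mul_X p i hp =>
      rw [map_mul]
      by_cases hi : i = 0
      · subst hi
        rw [killZ_X_zero, ← sub_mul]
        exact hp.mul_right _
      · obtain rfl : i = 1 := Fin.eq_one_of_ne_zero i hi
        rw [killZ_X_one, mul_zero, sub_zero]
        exact dvd_mul_left _ _

/-- **The cubic `X³ + a₂Z X² + (a₄Z² − a₁YZ) X + (a₆Z³ − a₃YZ² − Y²Z)` has no root in `K[Y, Z]`.**
If `r` were a root then modulo `Z` we get `r³ ≡ 0`, so `r = Z·s`; dividing the relation by `Z` and
reducing modulo `Z` again gives `Y² ≡ 0`, absurd. [folklore] -/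
theorem cubicInX_eval_ne_zero (r : MvPolynomial (Fin 2) K) :
    r ^ 3 + C W.a₂ * X 1 * r ^ 2 + (C W.a₄ * X 1 ^ 2 - C W.a₁ * X 0 * X 1) * r
      + (C W.a₆ * X 1 ^ 3 - C W.a₃ * X 0 * X 1 ^ 2 - X 0 ^ 2 * X 1) ≠ 0 := by
  intro h
  -- modulo `Z`: `(killZ r)³ = 0`, so `killZ r = 0`
  have h1 : killZ r = 0 := by
    have h' := congrArg killZ h
    simp only [map_add, map_sub, map_mul, map_pow, killZ_X_zero, killZ_X_one, killZ_C, map_zero,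
      mul_zero, zero_mul, add_zero, zero_pow (Nat.succ_ne_zero _), sub_self] at h'
    exact pow_eq_zero_iff (three_ne_zero) |>.mp h'
  -- hence `r = Z · s`
  obtain ⟨s, hs⟩ : (X 1 : MvPolynomial (Fin 2) K) ∣ r := by
    simpa [h1] using X_one_dvd_sub_killZ r
  subst hs
  -- divide the relation by `Z`
  have hT : (X 1 : MvPolynomial (Fin 2) K) *
      (X 1 ^ 2 * s ^ 3 + C W.a₂ * X 1 ^ 2 * s ^ 2 + (C W.a₄ * X 1 - C W.a₁ * X 0) * X 1 * s
        + (C W.a₆ * X 1 ^ 2 - C W.a₃ * X 0 * X 1 - X 0 ^ 2)) = 0 := by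
    rw [← h]; ring
  rcases mul_eq_zero.mp hT with h0 | hT'
  · exact X_ne_zero (1 : Fin 2) h0
  -- modulo `Z` again: `−Y² = 0`
  · have h' := congrArg killZ hT'
    simp only [map_add, map_sub, map_mul, map_pow, killZ_X_zero, killZ_X_one, killZ_C, map_zero,
      mul_zero, zero_mul, sub_zero, add_zero, zero_add, zero_pow (Nat.succ_ne_zero _), zero_sub,
      neg_eq_zero] at h'
    exact X_ne_zero (0 : Fin 2) (pow_eq_zero_iff two_ne_zero |>.mp h')

/-- **The Weierstrass cubic is irreducible** over any field `K` (for every Weierstrass equation,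
singular or not): under `K[X,Y,Z] ≅ K[Y,Z][X]` it is, up to sign, a monic cubic in `X` without
roots in `K[Y, Z]` (`cubicInX_eval_ne_zero`), and a monic polynomial of degree `3` over a domain
with no roots is irreducible (Mathlib `Monic.irreducible_iff_roots_eq_zero_of_degree_le_three`).
Compare Mathlib's `WeierstrassCurve.Affine.irreducible_polynomial` for the affine cubic and
Silverman, *AEC*, III.3.1 with Remark 3.1.1 (the Weierstrass plane cubic is irreducible even when
singular). [cite: SilvermanAEC2009, III.3.1] -/
theorem irreducible_polynomial : Irreducible W.polynomial := by
  set P : Cubic (MvPolynomial (Fin 2) K) := ⟨1, C W.a₂ * X 1, C W.a₄ * X 1 ^ 2 - C W.a₁ * X 0 * X 1,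
    C W.a₆ * X 1 ^ 3 - C W.a₃ * X 0 * X 1 ^ 2 - X 0 ^ 2 * X 1⟩ with hPdef
  have hassoc : Associated (-P.toPoly) P.toPoly := ⟨-1, by simp⟩
  rw [← MulEquiv.irreducible_iff (finSuccEquiv K 2), finSuccEquiv_polynomial, hassoc.irreducible_iff]
  have ha : P.a = 1 := rfl
  have hmonic : P.toPoly.Monic := Cubic.monic_of_a_eq_one ha
  have hdeg : P.toPoly.natDegree = 3 := Cubic.natDegree_of_a_ne_zero (by rw [ha]; exact one_ne_zero)
  rw [hmonic.irreducible_iff_roots_eq_zero_of_degree_le_three (by omega) (by omega),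
    Multiset.eq_zero_iff_forall_notMem]
  intro r hr
  rw [Polynomial.mem_roots hmonic.ne_zero, Polynomial.IsRoot.def, Cubic.toPoly] at hr
  simp only [hPdef, map_one, one_mul, Polynomial.eval_add, Polynomial.eval_mul,
    Polynomial.eval_pow, Polynomial.eval_C, Polynomial.eval_X] at hr
  exact W.cubicInX_eval_ne_zero r hr

/-- The Weierstrass cubic stays irreducible over every field extension (indeed over every field
`L` receiving a ring map from `K`): it is **absolutely irreducible**. [cite: SilvermanAEC2009, III.3.1] -/
theorem irreducible_map_polynomial {L : Type*} [Field L] (f : K →+* L) :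
    Irreducible (MvPolynomial.map f W.polynomial) := by
  rw [← map_polynomial]
  exact (W.map f).irreducible_polynomial

end Irreducible

end WeierstrassCurve.Projective
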